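import Summits.HodgeConjecture.HodgeConjecture.Theorems.EndoscopicMiddleDegreeMiddleThetaSpanHeckeIdempotents
import Literature.AlgebraicGeometry.ShimuraVarieties.HeckeCorrespondenceAction

/-!
# Stub `stub_rationalBlocks` (line `impure-barren-envelope` of crux
# `EndoscopicMiddleDegree.OrthogonalEnveloped`, stmt-HodgeConjecture-14300): the ℚ-blocks of the
# Hecke algebra of a compact ball quotient

Registered skeleton: line `IdeatorThreeSketch` of crux `OrthogonalEnveloped`; this is the file
`Theorems/EndoscopicMiddleDegreeOrthogonalEnvelopedRationalBlocks.lean` of the summit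
(`--supports stmt-HodgeConjecture-14300`).

WHAT IS PROVED. `stub_rationalBlocks`: for `m ∈ {1, 2}`, a ball-quotient datum `D` on `X` and the
Hecke algebra `𝓗 = Algebra.adjoin ℂ (range (D.heckeCorrespondenceAction (2(m+1)))) ⊆ End_ℂ H`,
`H = H^{2(m+1)}(X(ℂ); ℂ)`, there is a finite family `s` of pairwise orthogonal endomorphisms with
`Σ_{ε ∈ s} ε = 1`, each lying in `𝓗`, idempotent, central in `𝓗`, preserving rational classes, and
PRIMITIVE among the rational-preserving central idempotents `f` of `𝓗` (`f ε ∈ {0, ε}`): the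
`ℚ`-blocks of `𝓗` (for the genuine Hecke algebra, the `ℚ`-Hecke-isotypic pieces `⊕_σ W(σπ_f)`,
BMM Part 2 §1.9).

HOW (pure finite-dimensional algebra; nothing about Hecke operators is used beyond `𝓗 ⊆ End_ℂ H`).
(1) `H` is finite-dimensional (`finite_complexBetti` at `D.isSmoothProjective`), so the tree's
`exists_primitiveCentralIdempotents 𝓗` gives the `ℂ`-blocks `z₁, …, z_r`: non-zero, pairwise
orthogonal (two distinct primitive central idempotents are orthogonal), central idempotents of `𝓗`
summing to `1`, with `f zⱼ ∈ {0, zⱼ}` for every central idempotent `f` of `𝓗`.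
(2) `rationalBlocks_exists_finset_atoms` — the atoms of a finite Boolean algebra of idempotents: let
`P` be any property of elements of a ring stable under `1`, products and differences (here: "central
in `𝓗` and preserving rational classes"), and `z` a finite family as in (1), primitive towards the
`P`-idempotents. Every `P`-idempotent is `z_K = Σ_{j ∈ K} zⱼ` for the subset `K = {j | f zⱼ = zⱼ}`;
call `K` GOOD when `z_K` has `P`. Good subsets are stable under `∩` (`z_K z_L = z_{K ∩ L}`) and
differences (`z_{K ∖ L} = z_K - z_L`), and the whole index set is good (`z_univ = 1`). The ATOMS
(minimal non-empty good subsets) are pairwise disjoint and cover (a good subset containing `j` of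
minimal cardinality is an atom), so the `ε_A = z_A` over the atoms `A` are `P`-idempotents, pairwise
orthogonal, `Σ_A ε_A = z_univ = 1`, and primitive towards `P`-idempotents: `z_K ε_A = z_{K ∩ A}` with
`K ∩ A ∈ {∅, A}` by minimality. (3) Rational classes are stable under sums and `ℚ`-multiples
(`IsRationalClass.add/.smul`), hence under differences, so `P` is stable under `1`, `*`, `-`.
Sources: BMM arXiv:1306.1515 Part 2 §1.9 / Thm. 61 for the meaning; Curtis–Reiner §3D (block
idempotents) and Atiyah–Macdonald Ch. 8 for what is proved.
-/

noncomputable section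

-- The crux-workfile namespace `Summit.<P>.<Sub>.Cruxes.…` repeats `HodgeConjecture` (single-conjunct summit).
set_option linter.dupNamespace false

namespace Summit.HodgeConjecture.HodgeConjecture.Cruxes.OrthogonalEnveloped.ImpureBarrenEnvelope

open scoped BigOperators
open CategoryTheory MonoidalCategory CartesianMonoidalCategory
open Literature.AlgebraicGeometry.Motives (SchemeOver ComplexPoints IsSmoothProjective)
open Literature.AlgebraicGeometry.HodgeTheory
open Literature.AlgebraicGeometry.ShimuraVarieties
open Literature.AlgebraicTopology.SingularHomology
open Summit.HodgeConjecture.HodgeConjecture.Cruxes.MiddleThetaSpan.ConjugateDimensionSieve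
  (exists_primitiveCentralIdempotents)

/-! ## Helper lemmas (worker): atoms of a finite Boolean algebra of idempotents -/

/-- **Products of partial sums of orthogonal idempotents.** If the elements of the finite family `z`
of a ring are idempotent and pairwise orthogonal, then for `K, L ⊆ z`:
`(Σ_{a ∈ K} a) (Σ_{b ∈ L} b) = Σ_{a ∈ K ∩ L} a`. [folklore] -/
theorem rationalBlocks_sum_mul_sum_eq_sum_inter {E : Type*} [Ring E] [DecidableEq E]
    {z K L : Finset E} (hzi : ∀ a ∈ z, a * a = a) (hzo : ∀ a ∈ z, ∀ b ∈ z, a ≠ b → a * b = 0)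
    (hK : K ⊆ z) (hL : L ⊆ z) :
    (∑ a ∈ K, a) * (∑ b ∈ L, b) = ∑ a ∈ K ∩ L, a := by
  rw [Finset.sum_mul_sum, ← Finset.sum_ite_mem]
  refine Finset.sum_congr rfl fun a ha => ?_
  calc ∑ b ∈ L, a * b = ∑ b ∈ L, (if a = b then a else 0) :=
        Finset.sum_congr rfl fun b hb => by
          split_ifs with h
          · subst h
            exact hzi a (hK ha)
          · exact hzo a (hK ha) b (hL hb) h
    _ = if a ∈ L then a else 0 := Finset.sum_ite_eq L a fun _ => a

/-- **Atoms of a finite Boolean algebra of idempotents.** Let `P` be a property of elements of a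
ring `E` stable under `1`, products and differences, and `z ⊆ E` a finite family of non-zero,
pairwise orthogonal idempotents with `Σ_{a ∈ z} a = 1`, *primitive towards `P`-idempotents*:
`f a ∈ {0, a}` for every idempotent `f` with `P f` and every `a ∈ z`. Then there is a finite family
`s` of pairwise orthogonal `P`-idempotents with `Σ_{e ∈ s} e = 1`, each primitive towards
`P`-idempotents (`f e ∈ {0, e}`). Construction: every `P`-idempotent is `z_K := Σ_{a ∈ K} a` for
`K = {a ∈ z | f a = a}`; the subsets `K ⊆ z` with `P z_K` ("good") are stable under `∩`
(`z_K z_L = z_{K ∩ L}`) and differences (`z_{K ∖ L} = z_K - z_L`), and `z` is good (`z_z = 1`); the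
blocks are the `z_A` over the ATOMS `A` (minimal non-empty good subsets), which are pairwise disjoint
and cover `z` (a good subset containing `a` of minimal cardinality is an atom); primitivity:
`z_K z_A = z_{K ∩ A}` and `K ∩ A ∈ {∅, A}` by minimality. [folklore] -/
theorem rationalBlocks_exists_finset_atoms {E : Type*} [Ring E] (P : E → Prop) (h1 : P 1)
    (hmul : ∀ a b, P a → P b → P (a * b)) (hsub : ∀ a b, P a → P b → P (a - b))
    (z : Finset E) (hz0 : ∀ a ∈ z, a ≠ 0) (hzi : ∀ a ∈ z, a * a = a)
    (hzo : ∀ a ∈ z, ∀ b ∈ z, a ≠ b → a * b = 0) (hz1 : ∑ a ∈ z, a = 1)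
    (hzp : ∀ f, P f → f * f = f → ∀ a ∈ z, f * a = 0 ∨ f * a = a) :
    ∃ s : Finset E,
      (∀ e ∈ s, P e ∧ e * e = e ∧ ∀ f, P f → f * f = f → f * e = 0 ∨ f * e = e) ∧
      (∀ e ∈ s, ∀ e' ∈ s, e ≠ e' → e * e' = 0) ∧ ∑ e ∈ s, e = 1 := by
  classical
  -- `z_K z_L = z_{K ∩ L}` and `z_{K \ L} = z_K - z_L`
  have hmulσ : ∀ K L : Finset E, K ⊆ z → L ⊆ z →
      (∑ a ∈ K, a) * (∑ a ∈ L, a) = ∑ a ∈ K ∩ L, a :=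
    fun K L hK hL => rationalBlocks_sum_mul_sum_eq_sum_inter hzi hzo hK hL
  have hsubσ : ∀ K L : Finset E, L ⊆ K → ∑ a ∈ K \ L, a = (∑ a ∈ K, a) - ∑ a ∈ L, a :=
    fun K L h => eq_sub_of_add_eq (Finset.sum_sdiff h)
  -- good subsets (`z_K` has `P`) and atoms (minimal non-empty good subsets)
  let good : Finset E → Prop := fun K => K ⊆ z ∧ P (∑ a ∈ K, a)
  let atom : Finset E → Prop := fun A =>
    good A ∧ A.Nonempty ∧ ∀ K, good K → K ⊆ A → K.Nonempty → K = A
  have good_inter : ∀ K L : Finset E, good K → good L → good (K ∩ L) := fun K L hK hL =>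
    ⟨Finset.inter_subset_left.trans hK.1, by
      rw [← hmulσ K L hK.1 hL.1]
      exact hmul _ _ hK.2 hL.2⟩
  have good_sdiff : ∀ K L : Finset E, good K → good L → L ⊆ K → good (K \ L) :=
    fun K L hK hL h =>
      ⟨Finset.sdiff_subset.trans hK.1, by
        rw [hsubσ K L h]
        exact hsub _ _ hK.2 hL.2⟩
  have good_z : good z := ⟨Finset.Subset.refl _, by rw [hz1]; exact h1⟩
  -- two distinct atoms are disjoint
  have atom_disj : ∀ A A' : Finset E, atom A → atom A' → A ≠ A' → A ∩ A' = ∅ := by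
    intro A A' hA hA' hne
    by_contra h
    have hn : (A ∩ A').Nonempty := Finset.nonempty_iff_ne_empty.mpr h
    have hg := good_inter A A' hA.1 hA'.1
    exact hne ((hA.2.2 _ hg Finset.inter_subset_left hn).symm.trans
      (hA'.2.2 _ hg Finset.inter_subset_right hn))
  -- every `P`-idempotent is `z_K` for a good `K`
  have repr : ∀ f, P f → f * f = f → ∃ K : Finset E, good K ∧ ∑ a ∈ K, a = f := by
    intro f hf hff
    have key : f = ∑ a ∈ z.filter (fun a => f * a = a), a := by
      rw [Finset.sum_filter]
      calc f = f * ∑ a ∈ z, a := by rw [hz1, mul_one]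
        _ = ∑ a ∈ z, f * a := Finset.mul_sum _ _ _
        _ = ∑ a ∈ z, if f * a = a then a else 0 := Finset.sum_congr rfl fun a ha => by
          rcases hzp f hf hff a ha with h | h
          · rw [h]
            split_ifs with h'
            · exact h'
            · rfl
          · rw [h, if_pos rfl]
    exact ⟨_, ⟨Finset.filter_subset _ _, by rw [← key]; exact hf⟩, key.symm⟩
  -- every element of `z` lies in an atom: a good subset containing it of minimal cardinality
  have cover : ∀ a ∈ z, ∃ A : Finset E, atom A ∧ a ∈ A := by
    intro a ha
    obtain ⟨A, hA, hmin⟩ := Finset.exists_min_image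
      (z.powerset.filter fun K => good K ∧ a ∈ K) Finset.card
      ⟨z, Finset.mem_filter.mpr ⟨Finset.mem_powerset.mpr (Finset.Subset.refl _), good_z, ha⟩⟩
    obtain ⟨-, hAg, haA⟩ := Finset.mem_filter.mp hA
    have hmin' : ∀ K, good K → a ∈ K → ¬ K ⊂ A := fun K hK haK hlt =>
      not_le.mpr (Finset.card_lt_card hlt)
        (hmin K (Finset.mem_filter.mpr ⟨Finset.mem_powerset.mpr hK.1, hK, haK⟩))
    refine ⟨A, ⟨hAg, ⟨a, haA⟩, fun K hK hKA hKn => ?_⟩, haA⟩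
    by_contra hne
    by_cases haK : a ∈ K
    · exact hmin' K hK haK (Finset.ssubset_iff_subset_ne.mpr ⟨hKA, hne⟩)
    · exact hmin' (A \ K) (good_sdiff A K hAg hK hKA) (Finset.mem_sdiff.mpr ⟨haA, haK⟩)
        (Finset.sdiff_ssubset hKA hKn)
  -- the blocks: `z_A` over the atoms `A`
  set 𝒜 : Finset (Finset E) := z.powerset.filter atom
  have mem𝒜 : ∀ A, A ∈ 𝒜 ↔ atom A := fun A =>
    ⟨fun h => (Finset.mem_filter.mp h).2,
      fun h => Finset.mem_filter.mpr ⟨Finset.mem_powerset.mpr h.1.1, h⟩⟩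
  refine ⟨𝒜.image fun A => ∑ a ∈ A, a, ?_, ?_, ?_⟩
  · -- `P`, idempotent, primitive towards `P`-idempotents
    intro e he
    obtain ⟨A, hA, rfl⟩ := Finset.mem_image.mp he
    rw [mem𝒜] at hA
    refine ⟨hA.1.2, by rw [hmulσ A A hA.1.1 hA.1.1, Finset.inter_self], fun f hf hff => ?_⟩
    obtain ⟨K, hK, rfl⟩ := repr f hf hff
    rw [hmulσ K A hK.1 hA.1.1]
    by_cases hKA : (K ∩ A).Nonempty
    · exact Or.inr (by rw [hA.2.2 _ (good_inter K A hK hA.1) Finset.inter_subset_right hKA])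
    · exact Or.inl (by rw [Finset.not_nonempty_iff_eq_empty.mp hKA, Finset.sum_empty])
  · -- pairwise orthogonal
    intro e he e' he' hne
    obtain ⟨A, hA, rfl⟩ := Finset.mem_image.mp he
    obtain ⟨A', hA', rfl⟩ := Finset.mem_image.mp he'
    rw [mem𝒜] at hA hA'
    rw [hmulσ A A' hA.1.1 hA'.1.1, atom_disj A A' hA hA' (fun h => hne (by rw [h])),
      Finset.sum_empty]
  · -- `Σ_A z_A = z_{⋃ A} = z_z = 1`
    have hdisj : (↑𝒜 : Set (Finset E)).PairwiseDisjoint id := fun A hA A' hA' hne =>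
      Finset.disjoint_iff_inter_eq_empty.mpr
        (atom_disj A A' ((mem𝒜 A).mp hA) ((mem𝒜 A').mp hA') hne)
    have hinj : Set.InjOn (fun A : Finset E => ∑ a ∈ A, a) ↑𝒜 := by
      intro A hA A' hA' hAA'
      have hAA' : ∑ a ∈ A, a = ∑ a ∈ A', a := hAA'
      by_contra hne
      have hA := (mem𝒜 A).mp hA
      have hA' := (mem𝒜 A').mp hA'
      obtain ⟨a, haA⟩ := hA.2.1
      have h0 : ∑ x ∈ A, x = 0 := by
        calc ∑ x ∈ A, x = (∑ x ∈ A, x) * ∑ x ∈ A', x := by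
              rw [← hAA', hmulσ A A hA.1.1 hA.1.1, Finset.inter_self]
          _ = 0 := by
              rw [hmulσ A A' hA.1.1 hA'.1.1, atom_disj A A' hA hA' hne, Finset.sum_empty]
      have ha0 : a = 0 := by
        calc a = ∑ x ∈ A ∩ {a}, x := by
              rw [Finset.inter_singleton_of_mem haA, Finset.sum_singleton]
          _ = (∑ x ∈ A, x) * ∑ x ∈ ({a} : Finset E), x :=
              (hmulσ A {a} hA.1.1 (Finset.singleton_subset_iff.mpr (hA.1.1 haA))).symm
          _ = 0 := by rw [h0, zero_mul]
      exact hz0 a (hA.1.1 haA) ha0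
    have hcov : 𝒜.biUnion id = z := by
      refine Finset.Subset.antisymm
        (Finset.biUnion_subset.mpr fun A hA => ((mem𝒜 A).mp hA).1.1) fun a ha => ?_
      obtain ⟨A, hA, haA⟩ := cover a ha
      exact Finset.mem_biUnion.mpr ⟨A, (mem𝒜 A).mpr hA, haA⟩
    rw [Finset.sum_image hinj]
    calc ∑ A ∈ 𝒜, ∑ a ∈ A, a = ∑ a ∈ 𝒜.biUnion id, a := (Finset.sum_biUnion hdisj).symm
      _ = 1 := by rw [hcov, hz1]

/-! ## The registered stub (signature must stay BYTE-IDENTICAL) -/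

/-- **Stub 4 — the ℚ-block decomposition of the Hecke algebra (KNOWN: the `ℚ`-Hecke-isotypic pieces,
BMM Part 2 §1.9 / Thm 61; finite-dimensional linear algebra in Lean).** For `m ∈ {1,2}` and a datum
`D`, let `𝓗 = Algebra.adjoin ℂ (range (D.heckeCorrespondenceAction (2n)))` on `H = H²ⁿ(X(ℂ); ℂ)`,
`n = m + 1`. There is a finite family `s` of pairwise orthogonal endomorphisms summing to `1`, each of
which lies in `𝓗`, is idempotent, central in `𝓗`, preserves rational classes, and is PRIMITIVE among
the rational-preserving central idempotents `f` of `𝓗` (`f ε ∈ {0, ε}`). Proof: `H` is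
finite-dimensional (`finite_complexBetti D.isSmoothProjective`), so `𝓗` has `ℂ`-block idempotents
(`exists_primitiveCentralIdempotents`: non-zero, pairwise orthogonal central idempotents summing to
`1`, primitive among central idempotents); the `ℚ`-blocks are the sums of `ℂ`-blocks over the atoms of
the finite Boolean algebra of those subsets whose sum preserves rational classes
(`rationalBlocks_exists_finset_atoms` with `P` = "central in `𝓗` and rational-preserving", stable
under `1`, products and differences by `IsRationalClass.add/.smul`).
[cite: BergeronMillsonMoeglin2016Balls, Part 2 §1.9 and Thm. 61] -/
theorem stub_rationalBlocks :
    ∀ (m : ℕ) (X : SchemeOver ℂ) (D : UnitaryBallQuotientDatum (2 * (m + 1)) X), 1 ≤ m → m ≤ 2 →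
      ∃ s : Finset (Module.End ℂ (complexBetti X (2 * (m + 1)))),
        (∀ ε ∈ s,
          ε ∈ Algebra.adjoin ℂ (Set.range (D.heckeCorrespondenceAction (2 * (m + 1)))) ∧
          ε * ε = ε ∧
          (∀ T ∈ Algebra.adjoin ℂ (Set.range (D.heckeCorrespondenceAction (2 * (m + 1)))),
            T * ε = ε * T) ∧
          (∀ β, IsRationalClass β → IsRationalClass (ε β)) ∧
          (∀ f ∈ Algebra.adjoin ℂ (Set.range (D.heckeCorrespondenceAction (2 * (m + 1)))),
            f * f = f →
            (∀ T ∈ Algebra.adjoin ℂ (Set.range (D.heckeCorrespondenceAction (2 * (m + 1)))),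
              T * f = f * T) →
            (∀ β, IsRationalClass β → IsRationalClass (f β)) → f * ε = 0 ∨ f * ε = ε)) ∧
        (∀ ε ∈ s, ∀ ε' ∈ s, ε ≠ ε' → ε * ε' = 0) ∧
        ∑ ε ∈ s, ε = 1 := by
  intro m X D _ _
  haveI := finite_complexBetti D.isSmoothProjective (2 * (m + 1))
  set 𝓗 := Algebra.adjoin ℂ (Set.range (D.heckeCorrespondenceAction (2 * (m + 1))))
  -- the `ℂ`-blocks: primitive central idempotents of `𝓗`
  obtain ⟨z, hz, hz1⟩ := exists_primitiveCentralIdempotents 𝓗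
  -- rational classes are stable under differences
  have rat_sub : ∀ x y : complexBetti X (2 * (m + 1)), IsRationalClass x → IsRationalClass y →
      IsRationalClass (x - y) := fun x y hx hy => by
    have h := hx.add (hy.smul (-1))
    rwa [Rat.cast_neg, Rat.cast_one, neg_one_smul, ← sub_eq_add_neg] at h
  -- the atoms of the Boolean algebra of rational-preserving central idempotents
  obtain ⟨s, hs, ho, hsum⟩ := rationalBlocks_exists_finset_atoms
    (fun T : Module.End ℂ (complexBetti X (2 * (m + 1))) =>
      T ∈ 𝓗 ∧ (∀ S ∈ 𝓗, S * T = T * S) ∧ ∀ β, IsRationalClass β → IsRationalClass (T β))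
    ⟨𝓗.one_mem, fun S _ => by rw [mul_one, one_mul], fun β hβ => by
      rwa [Module.End.one_apply]⟩
    (fun a b ha hb => ⟨𝓗.mul_mem ha.1 hb.1,
      fun S hS => by rw [← mul_assoc, ha.2.1 S hS, mul_assoc, hb.2.1 S hS, mul_assoc],
      fun β hβ => by
        rw [Module.End.mul_apply]
        exact ha.2.2 _ (hb.2.2 β hβ)⟩)
    (fun a b ha hb => ⟨𝓗.sub_mem ha.1 hb.1,
      fun S hS => by rw [mul_sub, sub_mul, ha.2.1 S hS, hb.2.1 S hS],
      fun β hβ => by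
        rw [LinearMap.sub_apply]
        exact rat_sub _ _ (ha.2.2 β hβ) (hb.2.2 β hβ)⟩)
    z (fun a ha => (hz a ha).2.1) (fun a ha => (hz a ha).1.2.1)
    (fun a ha b hb hab => by
      -- distinct primitive central idempotents are orthogonal
      have hcomm : b * a = a * b := (hz a ha).1.2.2 b (hz b hb).1.1
      rcases (hz b hb).2.2 a (hz a ha).1 with h | h
      · exact h
      · rcases (hz a ha).2.2 b (hz b hb).1 with h' | h'
        · rw [← hcomm]
          exact h'
        · exact absurd (h'.symm.trans (hcomm.trans h)) hab)
    hz1 (fun f hf hff a ha => (hz a ha).2.2 f ⟨hf.1, hff, hf.2.1⟩)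
  refine ⟨s, fun ε hε => ?_, ho, hsum⟩
  obtain ⟨⟨h1, h2, h3⟩, h4, h5⟩ := hs ε hε
  exact ⟨h1, h4, h2, h3, fun f hf hff hfc hfr => h5 f ⟨hf, hfc, hfr⟩ hff⟩

end Summit.HodgeConjecture.HodgeConjecture.Cruxes.OrthogonalEnveloped.ImpureBarrenEnvelope

end
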